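import Mathlib

/-!
# `C¹`-convergence survives a smooth change of coordinates

If `u n → v` locally uniformly on `ℂ` together with the derivatives `fderiv ℝ (u n) → fderiv ℝ v`,
and `Λ` is `C^∞` on an open set `U` containing `v '' K` for a compact `K ⊆ ℂ`, then on `K` the
compositions `Λ ∘ u n → Λ ∘ v` converge uniformly together with their derivatives, and eventually
`u n '' K ⊆ U`.

The key tool is the "uniform continuity at a compact set" form of Heine–Cantor
(`IsCompact.uniformContinuousAt_of_continuousAt`): composing a uniformly convergent sequence on the
left with a map that is continuous at each point of a compact set containing the image of the
limit preserves uniform convergence.  It is applied once to `Λ` (the `C⁰` part) and once to the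
composition map `(p, B) ↦ (fderiv ℝ Λ p) ∘L B` along the pairs `(u n ζ, fderiv ℝ (u n) ζ)`
(the `C¹` part, after the chain rule).
-/

set_option linter.dupNamespace false

noncomputable section

open Filter Set Metric
open scoped ContDiff Topology

namespace Summit.SmoothPoincare4.SmoothPoincare4.Cruxes.TameOrBrodyR4.Sketch

namespace ComposeC1

/-- Composition on the left with a map that is continuous at every point of a compact set
containing the image of the limit preserves uniform convergence on a set. -/
theorem tendstoUniformlyOn_comp_left {α β γ ι : Type*} [UniformSpace β] [UniformSpace γ]
    {F : ι → α → β} {f : α → β} {p : Filter ι} {s : Set α} {t : Set β} (g : β → γ)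
    (ht : IsCompact t) (hg : ∀ b ∈ t, ContinuousAt g b) (hft : ∀ x ∈ s, f x ∈ t)
    (h : TendstoUniformlyOn F f p s) :
    TendstoUniformlyOn (fun i x => g (F i x)) (fun x => g (f x)) p s := by
  intro r hr
  filter_upwards [h _ (ht.uniformContinuousAt_of_continuousAt g hg hr)] with i hi x hx
  exact hi x hx (hft x hx)

/-- A sequence converging uniformly on `s` to a limit mapping `s` into a compact subset of an
open set `U` eventually maps `s` into `U`. -/
theorem eventually_mem_of_tendstoUniformlyOn {α β ι : Type*} [PseudoMetricSpace β]
    {F : ι → α → β} {f : α → β} {p : Filter ι} {s : Set α} {t U : Set β}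
    (ht : IsCompact t) (hU : IsOpen U) (htU : t ⊆ U) (hft : ∀ x ∈ s, f x ∈ t)
    (h : TendstoUniformlyOn F f p s) : ∀ᶠ i in p, ∀ x ∈ s, F i x ∈ U := by
  obtain ⟨δ, hδ, hδU⟩ := ht.exists_thickening_subset_open hU htU
  filter_upwards [Metric.tendstoUniformlyOn_iff.1 h δ hδ] with i hi x hx
  exact hδU (mem_thickening_iff.2 ⟨f x, hft x hx, by rw [dist_comm]; exact hi x hx⟩)

end ComposeC1

/-- Local notation for the model space `ℝ⁴ = EuclideanSpace ℝ (Fin 4)`. -/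
local notation "E4" => EuclideanSpace ℝ (Fin 4)

open ComposeC1 in
/-- (CC) `C¹`-convergence survives a smooth change of coordinates: if `u n → v` locally uniformly
on `ℂ` together with first derivatives, `Λ` is `C^∞` on an open `U`, and `K` is compact with
`v '' K ⊆ U`, then on `K` the maps `Λ ∘ u n → Λ ∘ v` converge uniformly together with their
derivatives, and eventually `u n '' K ⊆ U`. -/
theorem helper_composeC1Convergence (Λ : E4 → ℂ × ℂ) (U : Set E4) (hU : IsOpen U)
    (hΛ : ContDiffOn ℝ ∞ Λ U) (u : ℕ → ℂ → E4) (v : ℂ → E4) (hu : ∀ n, ContDiff ℝ ∞ (u n))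
    (hv : ContDiff ℝ ∞ v) (hloc : TendstoLocallyUniformly u v atTop)
    (hdloc : TendstoLocallyUniformly (fun n => fderiv ℝ (u n)) (fderiv ℝ v) atTop)
    (K : Set ℂ) (hK : IsCompact K) (hKU : ∀ ζ ∈ K, v ζ ∈ U) :
    TendstoUniformlyOn (fun n ζ => Λ (u n ζ)) (fun ζ => Λ (v ζ)) atTop K ∧
    TendstoUniformlyOn (fun n ζ => fderiv ℝ (fun ζ => Λ (u n ζ)) ζ)
      (fun ζ => fderiv ℝ (fun ζ => Λ (v ζ)) ζ) atTop K ∧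
    (∀ᶠ n in atTop, ∀ ζ ∈ K, u n ζ ∈ U) := by
  -- uniform convergence (of maps and derivatives) on the compact `K`
  have hK0 : TendstoUniformlyOn u v atTop K :=
    (tendstoLocallyUniformly_iff_forall_isCompact.1 hloc) K hK
  have hK1 : TendstoUniformlyOn (fun n => fderiv ℝ (u n)) (fderiv ℝ v) atTop K :=
    (tendstoLocallyUniformly_iff_forall_isCompact.1 hdloc) K hK
  -- the compact image `v '' K ⊆ U`
  have hvK : IsCompact (v '' K) := hK.image hv.continuous
  have hvKU : v '' K ⊆ U := by
    rintro _ ⟨ζ, hζ, rfl⟩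
    exact hKU ζ hζ
  have hmem : ∀ ζ ∈ K, v ζ ∈ v '' K := fun ζ hζ => mem_image_of_mem v hζ
  -- eventually `u n '' K ⊆ U`
  have hev : ∀ᶠ n in atTop, ∀ ζ ∈ K, u n ζ ∈ U :=
    eventually_mem_of_tendstoUniformlyOn hvK hU hvKU hmem hK0
  -- continuity / differentiability of `Λ` and continuity of `fderiv ℝ Λ` at points of `U`
  have hΛc : ∀ p ∈ U, ContinuousAt Λ p := fun p hp =>
    hΛ.continuousOn.continuousAt (hU.mem_nhds hp)
  have hΛd : ∀ p ∈ U, DifferentiableAt ℝ Λ p := fun p hp =>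
    (hΛ.differentiableOn (by simp)).differentiableAt (hU.mem_nhds hp)
  have hΛfc : ContinuousOn (fderiv ℝ Λ) U := hΛ.continuousOn_fderiv_of_isOpen hU (by simp)
  refine ⟨tendstoUniformlyOn_comp_left Λ hvK (fun b hb => hΛc b (hvKU hb)) hmem hK0, ?_, hev⟩
  -- pairs (point, derivative) converge uniformly on `K`
  have hG : TendstoUniformlyOn (fun n ζ => (u n ζ, fderiv ℝ (u n) ζ))
      (fun ζ => (v ζ, fderiv ℝ v ζ)) atTop K :=
    fun r hr => tendsto_diag.eventually ((hK0.prodMk hK1) r hr)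
  have hgK : IsCompact ((fun ζ => (v ζ, fderiv ℝ v ζ)) '' K) :=
    hK.image (hv.continuous.prodMk (hv.continuous_fderiv (by simp)))
  -- the composition map `(p, B) ↦ (fderiv ℝ Λ p) ∘L B` is continuous on the open `U ×ˢ univ`
  have hΦ : ContinuousOn (fun q : E4 × (ℂ →L[ℝ] E4) => (fderiv ℝ Λ q.1).comp q.2)
      (U ×ˢ (univ : Set (ℂ →L[ℝ] E4))) :=
    (hΛfc.comp continuousOn_fst fun q hq => hq.1).clm_comp continuousOn_snd
  have hΦc : ∀ q ∈ (fun ζ => (v ζ, fderiv ℝ v ζ)) '' K,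
      ContinuousAt (fun q : E4 × (ℂ →L[ℝ] E4) => (fderiv ℝ Λ q.1).comp q.2) q := by
    rintro _ ⟨ζ, hζ, rfl⟩
    exact hΦ.continuousAt ((hU.prod isOpen_univ).mem_nhds ⟨hKU ζ hζ, mem_univ _⟩)
  have hmain := tendstoUniformlyOn_comp_left _ hgK hΦc
    (fun ζ hζ => mem_image_of_mem (fun ζ => (v ζ, fderiv ℝ v ζ)) hζ) hG
  -- chain rule on `K` (eventually, once `u n '' K ⊆ U`) and for the limit
  refine (hmain.congr ?_).congr_right ?_
  · filter_upwards [hev] with n hn ζ hζ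
    exact (fderiv_fun_comp ζ (hΛd _ (hn ζ hζ)) ((hu n).differentiable (by simp) ζ)).symm
  · intro ζ hζ
    exact (fderiv_fun_comp ζ (hΛd _ (hKU ζ hζ)) (hv.differentiable (by simp) ζ)).symm

end Summit.SmoothPoincare4.SmoothPoincare4.Cruxes.TameOrBrodyR4.Sketch
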